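import Literature.MathematicalPhysics.QuantumFieldTheory.Balaban1983to89.B15Prop1IntrinsicOfFun

/-!
# `Balaban1983to89.B15Prop1IntrinsicOfRecord` — [Balaban1989LargeFieldI] Prop. 1 p. 194 / [Balaban1989LargeFieldII] pp. 357–359: ★★★ PROPOSITION 1 [IV]
# WITH ITS ANALYTIC-EXTENSION CLAUSE AT NODE 00's SOLUTION MAPS OF RECORD, FROM THE THREE ANALYTIC LETTERS (J1) joint holomorphy, (L2) the Hessian
# (1.7)–(1.9), (L3) the gradient — AND NOTHING ELSE BUT STRUCTURE: the (181) letter of p518722 is GONE (p. 194's invariance of (1.77) is the theorem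
# `B15Eq177ValueInvariance.fun177std_bgOfRecord_gaugeAct`; the class invariance for the v1.5 `CoP` record is `B15Eq177ValueInvarianceCoDiv`)

statement-level skeleton of published theorems with citation tags; proofs where landed; nothing here is a claim about
the Yang–Mills mass gap

Cell pub-ymgap, HUMAN RULING D-0062 (Track A full width), seat `pub-ymgap-dag-n12-c` (R134 acceleration seat (a), strategy s1 of DAG node N12 = [B15];
generation g6, fourth product; LOCATED-181 — see the headers of `B15Eq177ValueInvariance`, `B15Prop1LocalLettersOfFun`, `B15Prop1IntrinsicOfFun`).

WHAT THIS FILE PROVES (no `sorry`, no definition, no `… : Prop` fact; axioms standard).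
* §1 ★★★ `exists_domain_prop1Printed_lfVarOn_std_su2_box_intrinsic_analytic_ofRecord` — the conclusion of
  `B15Prop1IntrinsicAnalyticAtRecord.exists_domain_prop1Printed_lfVarOn_std_su2_box_intrinsic_analytic` (p518722) VERBATIM at `bg := Node00.bgOfRecord av reg`
  (the totalised (2.12) solution map of `Node00.SmallFieldChiOfRecord` in ANY gauge-invariant class `reg`, `k i ≤ m + K`), from (J1) `hGj`, (L2) `hlead` +
  `hsm`∕`hγle`, (L3) `hJ`, the class invariance `hreg` and the structural box∕margin∕constant hypotheses.
* AT THE v1.5 BACKGROUND OF RECORD `Node00.bgMSCoPOfRecord F 2 ν K k Ω = bgOfRecord (avOfRecord F 2 K) (regMSCoPOfRecord …)`: take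
  `hreg := B15Eq177ValueInvarianceCoDiv.gaugeAct_mem_regMSCoPOfRecord ν K k Ω` ([15] p. 278 «the spaces are invariant», PROVED there) — the instance is
  left to the consumer's file because the `Node00` record modules carry a `DecidableEq (PBond P k)` instance (`B6Prop26ReachTransplant`) under which the
  chain's slice types `GaugeSlice …` (classical instance, as in p518722) must be restated over `Classical.propDecidable`.

HONEST SCOPE.  Count-neutral; the three analytic letters are NODE 00's ([15] Thm 1 ∕ Prop. 9; [IV] p.193; [LF-II] pp.357–359) and are NOT proved here;
NOT a discharge of N12; nothing continuum ∕ OS ∕ mass-gap ∕ Clay.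
-/

noncomputable section

open Set Finset Metric
open scoped BigOperators Matrix RealInnerProductSpace Real InnerProductSpace

namespace Literature.MathematicalPhysics.QuantumFieldTheory.Balaban1983to89.B15Prop1IntrinsicOfRecord

open B15DeterminingSets GaugeField B16Sect1Backgrounds B15Prop1Carrier B8Eq17ClassAkV1
open B15Prop1SliceTaylorCalculus B15Prop1LocalLettersOfFun B15Prop1IntrinsicOfFun
open B15Prop1AnalyticExtClause (cplxVec cplxSlice anExt)
open B15Prop1ChartCalculusSU2 (E3)
open T4CubeChartGnomonic (SU2)
open B15Prop1ChartSU2 (su2Chart)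
open B15Prop1SliceCoordinates (GaugeSlice ιA freeBonds)
open T4AxialGaugeSmallField (castSite boxPlaqs)
open B6BondElimination (unitVec)
open B16Eq18Proof (box)
open B15Extension193 (extend)
open B15ShellGauge193 (shellGauge)
open B5Bounds167Lattice (formDk ofRealCfg)
open B14.Eq213DetSet B14.Eq216Concrete B15Sect1Instances B15Eq177GaugeInvariance B15Eq177ValueInvariance
open Literature.MathematicalPhysics.QuantumFieldTheory.BalabanImbrieJaffe1984to88.BIJ85Eq453GaugeField

/-! ## §1 At `Node00.bgOfRecord av reg`, any gauge-invariant class -/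

section Record

open Classical

variable {P : Params}

/-- ★★★ **PROPOSITION 1 [IV] WITH ITS ANALYTIC-EXTENSION CLAUSE AT NODE 00'S SOLUTION MAP OF RECORD, FROM THE THREE ANALYTIC LETTERS** —
the conclusion of `B15Prop1IntrinsicAnalyticAtRecord.exists_domain_prop1Printed_lfVarOn_std_su2_box_intrinsic_analytic` (p518722) VERBATIM at
`bg := Node00.bgOfRecord av reg` (the totalised (2.12) solution map of `Node00.SmallFieldChiOfRecord` in ANY gauge-invariant class `reg`; NODE 00's
`bgMSOfRecord`∕`bgMSCoOfRecord`∕`…CoP` are such), its (181) letter GONE — p. 194's invariance of (1.77) is the theorem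
`B15Eq177ValueInvariance.fun177std_bgOfRecord_gaugeAct`.  WHAT A CONSUMER SUPPLIES: (J1) `hGj` joint holomorphy of `(p, B′) ↦ A(U_{k,Z}(exp(iB′)·
ext(exp(ip)V_k)))` on the sup-ball of radius `R` with bound `𝓐` at `eR`-regular data ([15] Thm 1 ∕ Prop. 9; [IV] p.193; [LF-II] p.359), (L2) `hlead` +
`hsm`∕`hγle` ((1.7)–(1.9) for the slice Hessian), (L3) `hJ` (p.359, the gradient at regular data), the class invariance `hreg`, `k i ≤ m + K`, and the
structural box∕margin∕constant hypotheses. [cite: Balaban1989LargeFieldI, Prop. 1 (1.77)–(1.78) p.194 (incl. the last clause), p.193;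
Balaban1989LargeFieldII, (1.7)–(1.9) p.358, (1.11)–(1.13) p.359; Balaban1985Variational, Prop. 9 p.309] -/
theorem exists_domain_prop1Printed_lfVarOn_std_su2_box_intrinsic_analytic_ofRecord (hd3 : 3 ≤ P.d) (h0 : 0 < P.d) {ι : Type}
    (av : ∀ j, Averaging P j SU2) {reg : Set (GaugeField P 0 SU2)}
    (hreg : ∀ (w : GaugeTransf P 0 SU2) (U : GaugeField P 0 SU2), U ∈ reg → gaugeAct w U ∈ reg)
    (M₁ : ℕ) (Z Λ : ι → Set (Site P 0)) (k : ι → ℕ) (M : ι → ℝ) (hk : ∀ i, k i ≤ P.m + P.K)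
    (eR : ι → ℝ) (heR : ∀ i, 0 < eR i)
    (T : ∀ i, Finset (PBond P (k i)))
    (lo hi : ι → Fin P.d → ℤ) (n : ι → ℕ) (hn : ∀ i κ, hi i κ ≤ lo i κ + n i) (hN : ∀ i, n i + 2 < P.sitesPerDir (k i))
    (hbox : ∀ i, pts (k i) (Λ i) = (castSite '' Set.Icc (lo i) (hi i) : Set (Site P (k i))))
    (hZ : ∀ i, (boxPlaqs (lo i - 1) (hi i + 1) : Set (Plaq P (k i))) ⊆ plaqsInside (pts (k i) (Z i)))
    -- (`G₀`: the image is taken with the classical `DecidableEq` instance, as in p518722's statement — any other instance gives the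
    -- same `Finset`, the instances forming a subsingleton)
    (hTG0 : ∀ i, T i = @Finset.image (Fin P.d → ℤ) (PBond P (k i)) (fun a b => Classical.propDecidable (a = b))
      (fun x => (⟨castSite (x - unitVec ⟨0, h0⟩), ⟨0, h0⟩⟩ : PBond P (k i))) (box (fun κ => (hi i κ - lo i κ + 1).toNat) (lo i)))
    (hN5 : ∀ i κ, ((hi i κ - lo i κ + 1).toNat : ℤ) + 5 < P.sitesPerDir (k i))
    (K : ι → ℕ) (hK1 : ∀ i, 1 ≤ K i) (hKn : ∀ i κ, (hi i κ - lo i κ + 1).toNat ≤ K i)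
    (ext : ∀ i, GaugeField P (k i) SU2 → GaugeField P (k i) SU2)
    (hext : ∀ i Vk, ext i Vk = extend (pts (k i) (Λ i)) (shellGauge Vk (lo i) (hi i)) Vk)
    (hlohi : ∀ i, lo i ≤ hi i)
    {γ cJ bx : ℝ} (hγ : 0 < γ) (hcJ : 0 ≤ cJ) (hbx : 0 ≤ bx)
    (hbxM : ∀ i, 12 * (P.d : ℝ) * ((n i : ℝ) + 2) ^ 2 ≤ bx * (M i) ^ 2)
    {Cerr R 𝓐 : ι → ℝ} (hM : ∀ i, 1 ≤ (M i)) (hR : ∀ i, 0 < R i) (h𝓐 : ∀ i, 0 ≤ 𝓐 i)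
    (n' : ι → ℕ) (hn' : ∀ i, 1 ≤ n' i)
    -- (J1) the JOINT holomorphic extension of print's function in the datum perturbation and the field
    (hGj : ∀ i Vk, PlaqSmallOn (plaqsInside (pts (k i) (Z i ∩ (Λ i)ᶜ))) (eR i) Vk →
      ∃ 𝒢 : VecField P (k i) (EuclideanSpace ℂ (Fin 3)) × VecField P (k i) (EuclideanSpace ℂ (Fin 3)) → ℂ,
        DifferentiableOn ℂ 𝒢 (ball 0 (R i)) ∧
        (∀ z ∈ ball (0 : VecField P (k i) (EuclideanSpace ℂ (Fin 3)) × VecField P (k i) (EuclideanSpace ℂ (Fin 3))) (R i), ‖𝒢 z‖ ≤ 𝓐 i) ∧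
        ∀ p B' : VecField P (k i) E3, ‖p‖ < R i → ‖B'‖ < R i →
          𝒢 (cplxVec p, cplxVec B') =
            ((fun177std (Node00.bgOfRecord av reg) M₁ (Z i) (k i) (expMul su2Chart B' (ext i (expMul su2Chart p Vk))) : ℝ) : ℂ))
    -- (L2) (1.7)–(1.9) p.358 for the Hessian of the slice function at `0`
    (hlead : ∀ i Vk, PlaqSmallOn (plaqsInside (pts (k i) (Z i ∩ (Λ i)ᶜ))) (eR i) Vk →
      ∀ X : GaugeSlice (pts (k i) (Λ i)) (T i) E3,
      |⟪X, (fderiv ℝ (rGrad (pts (k i) (Λ i)) (T i)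
              (sliceFn (pts (k i) (Λ i)) (T i) (fun177std (Node00.bgOfRecord av reg) M₁ (Z i) (k i)) (ext i Vk))) 0) X⟫ -
          ∑ a : Fin 3, formDk (n' i) (fun _ : Fin P.d => P.sitesPerDir (k i))
            (ofRealCfg (fun _ : Fin P.d => P.sitesPerDir (k i)) fun j =>
              ιA (pts (k i) (Λ i)) (T i) X ⟨j.1, j.2⟩ a)| ≤ Cerr i * ‖X‖ ^ 2)
    (hsm : ∀ i, Cerr i ≤ (4 / Real.pi ^ 2) ^ (P.d + 2) / (2 * (3 * (K i : ℝ) ^ 2 + 2 * (K i : ℝ) ^ 4)))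
    (hγle : ∀ i, γ / (M i) ^ 5 ≤ (4 / Real.pi ^ 2) ^ (P.d + 2) / (2 * (3 * (K i : ℝ) ^ 2 + 2 * (K i : ℝ) ^ 4)))
    -- (L3) p.359: the gradient at `0` is small at regular data
    (hJ : ∀ i ε Vk, 0 < ε → ε ≤ eR i → PlaqSmallOn (plaqsInside (pts (k i) (Z i ∩ (Λ i)ᶜ))) ε Vk →
      ‖rGrad (pts (k i) (Λ i)) (T i)
        (sliceFn (pts (k i) (Λ i)) (T i) (fun177std (Node00.bgOfRecord av reg) M₁ (Z i) (k i)) (ext i Vk)) 0‖ ≤ cJ * ε)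
    : ∃ a₁ : ι → ℝ, (∀ i, 0 < a₁ i) ∧
      B15.Prop1Printed (lfVarOn su2Chart fun i => InstOn.std (Node00.bgOfRecord av reg) M₁ (Z i) (Λ i) (k i) (M i) (a₁ i)
        (anExt (pts (k i) (Λ i)) (T i) (fun177std (Node00.bgOfRecord av reg) M₁ (Z i) (k i)) (ext i)
          (min (1 / 2) (min (R i / 8) (γ / (M i) ^ 5 * (R i / 2) ^ 2 / (48 * (4 * 𝓐 i / R i + 1))))))) :=
  exists_domain_prop1Printed_lfVarOn_ofFun_intrinsic_analytic hd3 h0 Z Λ k M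
    (fun i => fun177std (Node00.bgOfRecord av reg) M₁ (Z i) (k i))
    (fun i u V => fun177std_bgOfRecord_gaugeAct av hreg M₁ (Z i) (hk i) u V) eR heR T lo hi n hn hN hbox hZ hTG0 hN5 K hK1 hKn ext hext
    hlohi hγ hcJ hbx hbxM hM hR h𝓐 n' hn' hGj hlead hsm hγle hJ

end Record

end Literature.MathematicalPhysics.QuantumFieldTheory.Balaban1983to89.B15Prop1IntrinsicOfRecord

end
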